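import Summits.Schanuel.Schanuel.Theorems.RootDecomp1EEStableRung
import Summits.Schanuel.Schanuel.Theorems.RootDecomp1ArgumentCells
import Summits.Schanuel.Schanuel.Theorems.RootDecomp1ValueCells

/-!
# RootDecomp1 — ROUND 15 «AdditiveCells» (decomp-schanuel, lens 1 «grading / quantitative ladder», gen 15)

Target served: `_root_.Schanuel` through `route-Schanuel-RootDecomp1` (draft rev 22), deciding theorem
`closes (h₂ : SchanuelTwo) (hK) (hD : DefectOneSchanuel) (hU : RationalImageSchanuel) (hG) (hC)`, `Cⁿᵘ` split into
**D** = `DisjointSaturatedEssentialSchanuel` (stmt-Schanuel-30353, entanglement grade `ε = 0`) and **Cᵉ** (stmt-30352).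

## The lever (one line)

On the DISJOINT stratum `ε = 0` (the split hypothesis `trdeg ℚ(z) + trdeg ℚ(e^z) ≤ trdeg ℚ(z, e^z)` carried by item D)
independently certified ONE-SIDED bounds ADD: `a ≤ trdeg ℚ(z)`, `v ≤ trdeg ℚ(e^z)` give `a + v ≤ trdeg ℚ(z, e^z)`.
Item B (`DefectOneSchanuel`, stmt-25020, `n ≤ t + 1`) needs `a + v ≥ n − 1`; items S / D need `a + v ≥ n`
(§3 `le_trdeg_succ_of_additive_cert`, `le_trdeg_of_additive_cert`).  Certificates in the tree: ARGUMENT side `a = 1`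
from one transcendental entry; VALUE side `v = m` from `m` ℚ-free algebraic numbers in `span_ℚ z`
(Lindemann–Weierstrass, §2 `le_valDegree_of_lwSpan`) and `v = 2` from an ALGEBRAIC GRID `x_i y_j ∈ span_ℚ z`,
`x ⊂ ℚ̄`, `d + 2ℓ ≤ dℓ` (Theorem 2.9, `t₁`-clause; §2 `two_le_valDegree_of_algebraicGrid` — round 14's cubic-line
lemma is its case `d = ℓ = 3`; NEW teeth at `n = 4`: `(d, ℓ) = (4, 2)`, any algebraic frame with one irrational
algebraic multiplier, and `(3, 3)` on any number-field line of degree `≥ 3`).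

## What this round proves (0 sorry; every `h29` binder is the tree THEOREM `smallTrdeg_thm_2_9_pos_holds`)

* §4 **ITEM B AT LENGTH 4 IS DECIDED ON THE DISJOINT STRATUM over three value-two cells** (critic standard (ix)(ii):
  «B₄ on a sub-family that is not the saturation instance — e.g. 𝕃-free tuples with `trdeg ℚ(z) = 1`»):
  `defectOneSchanuel_four_cell_lwPair` (two ℚ-free algebraic numbers in the span), `…_cell_numberFieldLine`
  (`μ·ℚ(β) ∩ powers ⊂ span`, `[ℚ(β):ℚ] ≥ 3`), `…_cell_algebraicFrame` (`span ⊇ μ·(a, ρa)`, `a ⊂ ℚ̄` ℚ-free of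
  length `≥ 4`, `ρ ∈ ℚ̄ ∖ ℚ`) — each = the item's binders VERBATIM with `n ≤ 4`, the cell and the split inserted;
  `1 + 2 = 3 = n − 1`.  Members with `trdeg ℚ(z) = 1`, 𝕃-free: `π·(1, ζ₅, ζ₅², ζ₅³)` (companion file
  `AdditiveCellsMembers`).  Lens 2's round-8 table read the TOTAL degree on such lines (`t ≥ 2 < 3`: undecided) and
  its layer-4 theorem is conditional on `WaldschmidtConjecture_2_3`; on `ε = 0` the same instruments DECIDE B₄.
* §5 **ITEM D AT EVERY LENGTH on LW-saturated spans** (`n − 1` ℚ-free algebraic numbers in `span_ℚ z`, ANY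
  remaining entry): `disjointSaturatedEssentialSchanuel_lwSpan` (item binders verbatim) — the any-base completion of
  the round-6 `logCons` calibration cell, OUTSIDE round 14's E-stable stratum (such spans are plain for transcendental
  heads).
* §6 **THE FIRST CELL OF D₃ OUTSIDE THE STRATUM — power lines `(w, w², w³)`, `w ∉ ℚ̄`** (standard (ix)(i″)):
  `powerTriple_linearIndependent`, `powerTriple_plain` (NO irrational multiplier: outside the E-stable stratum),
  `argDegree_powerTriple` (`trdeg ℚ(z) = 1`: cell row `(1, ·)`), and the REDUCTION
  `disjointSchanuel_powerTriple_iff`: under `ε = 0`, D₃ at `(w, w², w³)` ⟺ `2 ≤ trdeg ℚ(e^w, e^{w²}, e^{w³})`.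
  No instrument in the tree or in print certifies two algebraically independent VALUES on a 3-dimensional span that
  is not E-stable (Theorem 2.9 needs `d + 2ℓ ≤ dℓ` with `x ⊂ ℚ̄` or `dℓ ≥ 2(d + ℓ)`: a `d × ℓ` grid with
  `d, ℓ ≥ 2` inside a 3-dimensional span forces E-stability — lens 2 `eStable_of_two_dilates`; Brownawell–Waldschmidt
  needs two logarithms of algebraic numbers in the span, excluded for `w ∉ 𝓛`-lines) — so this cell is BOOKED OPEN
  with its deciding input named (`NODE-g15.md` §3, instrument card), not decided.
* §3 the additive principle; §2 the certificates; §1 value transport (from round 14, restated to keep this file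
  independent of the unported `RootDecomp1ValueCells`).

## Ceiling (BC9-style, this method family)
With {LW, Theorem 2.9} the disjoint B-ladder certifies exactly `n ≤ 4` (`a = 1`, `v ≤ 2` unless `span ∩ ℚ̄` is
large); the first disjoint grade these instruments do not reach is B₅ on quintic frames (`1 + 2 = 3 < 4`), and D
stops at `n = 3` outside LW-saturated / E-stable spans (§6).

## Sources
[cite: NesterenkoPhilippon2001, Ch. 14 Theorem 2.9 (`t₁`-clause `d + 2ℓ ≤ dℓ`)] · [cite: BakerTNT1975, Ch. 12
Thm 12.1] · Lindemann–Weierstrass (tree theorem `LindemannWeierstrass.AlgIndep_holds`).  Tree: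
`Literature.Barriers.Schanuel.smallTrdeg_thm_2_9_pos` (+ `_holds`, module `LargeTranscendenceDegreeThm29Holds`, not
built on the farm 2026-08-30 — hence the binder, the 1E / lens-2 / round-14 precedent).

## Port (three parts, each < 400 lines)
Part 1 = this file `Summits/Schanuel/Schanuel/Theorems/RootDecomp1AdditiveCells.lean` (§§1–4; imports as below, all
built; `--supports stmt-Schanuel-25020`, item B).  Part 2 = `RootDecomp1AdditiveCellsD.lean` (§§5–6, imports part 1;
`--supports stmt-Schanuel-30353`, item D).  Part 3 = `RootDecomp1AdditiveCellsMembers.lean` (literal members, imports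
part 2).  No `def … : Prop`, no `sorry`, no new axioms; the only data def is `powerTriple` (part 2).
-/

set_option linter.dupNamespace false

noncomputable section

namespace Summit.Schanuel.Schanuel.Theorems.RootDecomp1AdditiveCells

open Complex IntermediateField Module Polynomial
open Literature.NumberTheory.Transcendental (exists_nsmul_mem_span_int)
open Literature.Barriers.Schanuel (gridExp gridField₁ smallTrdeg_thm_2_9_pos)
open Summit.Schanuel.Schanuel.Theorems.RootDecomp1EAnchor (isAlgebraic_of_mem_adjoin
  trdeg_adjoin_le_of_isAlgebraic trdeg_adjoin_le_nat trdeg_adjoin_union_le exists_nat_eq_of_le_natCast)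
open Summit.Schanuel.Schanuel.Theorems.RootDecomp1EEStableRung (one_le_trdeg_adjoin_of_transcendental
  mul_mem_span_of_gens)
open Summit.Schanuel.Schanuel.Theorems.RootDecomp1ValueCells (exp_isAlgebraic_vals_of_mem_span valDegree_le_of_mem_span
  exp_mem_vals_of_mem_span_int)
open Summit.Schanuel.Schanuel.Theorems.RootDecomp1ArgumentCells (trdeg_args_le trdeg_vals_le
  trdeg_args_le_one_of_isAlgebraic_adjoin_singleton le_valDegree_of_exp_algebraic_mem)

/-! ## §1  Value-side transport (round 14 §1, restated): exponentials of the span are algebraic over `ℚ(e^z)` -/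

/-! ## §2  VALUE CERTIFICATES: `m ≤ trdeg ℚ(e^z)` from the span alone -/

/-- **LW VALUE CERTIFICATE.**  `m` ℚ-free ALGEBRAIC numbers inside `span_ℚ z` give `m ≤ trdeg ℚ(e^z)`
(Lindemann–Weierstrass: `e^{b_1}, …, e^{b_m}` algebraically independent, and algebraic over `ℚ(e^z)` by §1). -/
theorem le_valDegree_of_lwSpan {n m : ℕ} (z : Fin n → ℂ) (b : Fin m → ℂ)
    (hb : LinearIndependent ℚ b) (hbalg : ∀ j, IsAlgebraic ℚ (b j))
    (hmem : ∀ j, b j ∈ Submodule.span ℚ (Set.range z)) :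
    (m : Cardinal) ≤ Algebra.trdeg ℚ ↥(adjoin ℚ (Set.range (cexp ∘ z))) :=
  (le_valDegree_of_exp_algebraic_mem b b hbalg hb fun j => subset_adjoin ℚ _ ⟨j, rfl⟩).trans
    (valDegree_le_of_mem_span hmem)

/-- **GRID VALUE CERTIFICATE (Theorem 2.9, `t₁`-clause, transported to the value field).**  An ALGEBRAIC GRID in
the span — `x ⊂ ℚ̄` ℚ-free of length `d`, `y` ℚ-free of length `ℓ`, all products `x_i y_j ∈ span_ℚ z`, with
`d + 2ℓ ≤ dℓ` — certifies `2 ≤ trdeg ℚ(e^z)`: `K₁ = ℚ(x, e^{x_i y_j})` has `trdeg ≥ 2` and is algebraic over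
`ℚ(e^z)`.  Teeth: `(d, ℓ) ∈ {(3,3), (4,2), (6,2), …}`; round 14's cubic-line lemma is `(3,3)` with `y = z₀·x`. -/
theorem two_le_valDegree_of_algebraicGrid (h29 : smallTrdeg_thm_2_9_pos) {n d l : ℕ} (z : Fin n → ℂ)
    (x : Fin d → ℂ) (y : Fin l → ℂ) (hd : 1 ≤ d) (hl : 1 ≤ l)
    (hx : LinearIndependent ℚ x) (hy : LinearIndependent ℚ y) (hxalg : ∀ i, IsAlgebraic ℚ (x i))
    (hmem : ∀ i j, x i * y j ∈ Submodule.span ℚ (Set.range z)) (hdl : d + 2 * l ≤ d * l) :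
    (2 : Cardinal) ≤ Algebra.trdeg ℚ ↥(adjoin ℚ (Set.range (cexp ∘ z))) := by
  have h2 := (h29 d l x y hd hl hx hy).2.1 hdl
  refine h2.trans ?_
  set V : IntermediateField ℚ ℂ := adjoin ℚ (Set.range (cexp ∘ z)) with hV
  show Algebra.trdeg ℚ ↥(adjoin ℚ (Set.range x ∪ Set.range (gridExp x y))) ≤ Algebra.trdeg ℚ ↥V
  apply trdeg_adjoin_le_of_isAlgebraic
  rintro t (⟨i, rfl⟩ | ⟨p, rfl⟩)
  · exact (hxalg i).tower_top (L := ↥V)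
  · show IsAlgebraic ↥V (cexp (x p.1 * y p.2))
    exact exp_isAlgebraic_vals_of_mem_span (hmem p.1 p.2)

/-- The first `k` powers of an algebraic number of degree `≥ k` are ℚ-free. -/
theorem linearIndependent_pow_castLE {β : ℂ} {k : ℕ} (hk : k ≤ (minpoly ℚ β).natDegree) :
    LinearIndependent ℚ fun i : Fin k => β ^ (i : ℕ) := by
  exact (linearIndependent_pow (K := ℚ) β).comp (Fin.castLE hk) (Fin.castLE_injective hk)

/-- Scaling a ℚ-free family by a non-zero complex number keeps it ℚ-free. -/
theorem linearIndependent_mul_left {k : ℕ} {x : Fin k → ℂ} (hx : LinearIndependent ℚ x) {μ : ℂ} (hμ : μ ≠ 0) :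
    LinearIndependent ℚ fun i => μ * x i := by
  have hker : LinearMap.ker (LinearMap.mulLeft ℚ μ) = ⊥ :=
    LinearMap.ker_eq_bot.mpr (mul_right_injective₀ hμ)
  exact (hx.map' (LinearMap.mulLeft ℚ μ) hker)

/-- **NUMBER-FIELD-LINE VALUE CERTIFICATE** (`(d, ℓ) = (3, 3)` on `x = (1, β, β²)`, `y = μ·x`): if `span_ℚ z`
contains `μβ^k` for all `k`, with `β` algebraic of degree `≥ 3` and `μ ≠ 0`, then `2 ≤ trdeg ℚ(e^z)`.  At `n = 4`:
every E-stable QUARTIC LINE `μ·(1, β, β², β³)` (round 8's open B₄ leaf, any base `μ`). -/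
theorem two_le_valDegree_of_numberFieldLine (h29 : smallTrdeg_thm_2_9_pos) {n : ℕ} (z : Fin n → ℂ) {β μ : ℂ}
    (hβ : IsAlgebraic ℚ β) (hdeg : 3 ≤ (minpoly ℚ β).natDegree) (hμ : μ ≠ 0)
    (hmem : ∀ k : ℕ, μ * β ^ k ∈ Submodule.span ℚ (Set.range z)) :
    (2 : Cardinal) ≤ Algebra.trdeg ℚ ↥(adjoin ℚ (Set.range (cexp ∘ z))) := by
  have hx : LinearIndependent ℚ fun i : Fin 3 => β ^ (i : ℕ) := linearIndependent_pow_castLE hdeg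
  have hy : LinearIndependent ℚ fun j : Fin 3 => μ * β ^ (j : ℕ) := linearIndependent_mul_left hx hμ
  refine two_le_valDegree_of_algebraicGrid h29 z (fun i : Fin 3 => β ^ (i : ℕ)) (fun j : Fin 3 => μ * β ^ (j : ℕ))
    (by norm_num) (by norm_num) hx hy (fun i => hβ.pow _) ?_ (by norm_num)
  intro i j
  have e : β ^ (i : ℕ) * (μ * β ^ (j : ℕ)) = μ * β ^ ((i : ℕ) + (j : ℕ)) := by ring
  rw [e]
  exact hmem _

/-- `(μ, μρ)` is ℚ-free for `μ ≠ 0` and `ρ ∉ ℚ`. -/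
theorem pair_linearIndependent_of_irrational {μ ρ : ℂ} (hμ : μ ≠ 0) (hρ : ρ ∉ Set.range (algebraMap ℚ ℂ)) :
    LinearIndependent ℚ ![μ, μ * ρ] := by
  rw [LinearIndependent.pair_iff]
  intro s t hst
  have h0 : μ * ((s : ℂ) + (t : ℂ) * ρ) = 0 := by
    have : (s : ℂ) * μ + (t : ℂ) * (μ * ρ) = 0 := by simpa [Rat.smul_def] using hst
    linear_combination this
  have h1 : (s : ℂ) + (t : ℂ) * ρ = 0 := by
    rcases mul_eq_zero.mp h0 with h | h
    · exact absurd h hμ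
    · exact h
  by_cases ht : t = 0
  · subst ht
    have hs : (s : ℂ) = 0 := by simpa using h1
    exact ⟨by exact_mod_cast hs, rfl⟩
  · exfalso
    apply hρ
    refine ⟨-s / t, ?_⟩
    have htC : (t : ℂ) ≠ 0 := by exact_mod_cast ht
    rw [eq_ratCast, Rat.cast_div, Rat.cast_neg, eq_comm, eq_div_iff htC]
    linear_combination h1

/-- **ALGEBRAIC-FRAME VALUE CERTIFICATE** (`(d, ℓ) = (d, 2)`, `d ≥ 4`): if `span_ℚ z` contains `μ·a` and `μρ·a`
for an ALGEBRAIC ℚ-free frame `a` of length `d ≥ 4`, `ρ ∈ ℚ̄ ∖ ℚ`, `μ ≠ 0`, then `2 ≤ trdeg ℚ(e^z)`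
(`d + 4 ≤ 2d`).  At `n = 4`: every E-stable span `μ·K₀` with `K₀ ⊂ ℚ̄` four-dimensional (quartic lines,
biquadratic `μ·(1, √2, √3, √6)`, two quadratic blocks `μ·(1, √2, γ, γ√2)` …), ANY base `μ`. -/
theorem two_le_valDegree_of_algebraicFrame (h29 : smallTrdeg_thm_2_9_pos) {n d : ℕ} (z : Fin n → ℂ)
    (a : Fin d → ℂ) {ρ μ : ℂ} (hd : 4 ≤ d) (ha : LinearIndependent ℚ a) (haalg : ∀ i, IsAlgebraic ℚ (a i))
    (hρ : ρ ∉ Set.range (algebraMap ℚ ℂ)) (hμ : μ ≠ 0)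
    (hmem₀ : ∀ i, μ * a i ∈ Submodule.span ℚ (Set.range z))
    (hmem₁ : ∀ i, μ * ρ * a i ∈ Submodule.span ℚ (Set.range z)) :
    (2 : Cardinal) ≤ Algebra.trdeg ℚ ↥(adjoin ℚ (Set.range (cexp ∘ z))) := by
  refine two_le_valDegree_of_algebraicGrid h29 z a ![μ, μ * ρ] (by omega) (by norm_num) ha
    (pair_linearIndependent_of_irrational hμ hρ) haalg ?_ (by nlinarith)
  intro i j
  fin_cases j
  · have e : a i * μ = μ * a i := mul_comm _ _
    simpa [e] using hmem₀ i
  · have e : a i * (μ * ρ) = μ * ρ * a i := by ring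
    simpa [e] using hmem₁ i

/-! ## §3  THE ADDITIVE PRINCIPLE on the disjoint stratum `ε = 0` -/

/-- **ADDITIVE CERTIFICATE ⟹ DEFECT ≤ 1.**  Under the split `trdeg ℚ(z) + trdeg ℚ(e^z) ≤ trdeg ℚ(z, e^z)`,
certified `a ≤ trdeg ℚ(z)` and `v ≤ trdeg ℚ(e^z)` with `n ≤ a + v + 1` give item B's conclusion `n ≤ t + 1`. -/
theorem le_trdeg_succ_of_additive_cert {n : ℕ} (z : Fin n → ℂ) {a v : ℕ}
    (ha : (a : Cardinal) ≤ Algebra.trdeg ℚ ↥(adjoin ℚ (Set.range z)))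
    (hv : (v : Cardinal) ≤ Algebra.trdeg ℚ ↥(adjoin ℚ (Set.range (cexp ∘ z))))
    (hsplit : Algebra.trdeg ℚ ↥(adjoin ℚ (Set.range z)) + Algebra.trdeg ℚ ↥(adjoin ℚ (Set.range (cexp ∘ z))) ≤
      Algebra.trdeg ℚ ↥(adjoin ℚ (Set.range z ∪ Set.range (cexp ∘ z))))
    (hn : n ≤ a + v + 1) :
    (n : Cardinal) ≤ Algebra.trdeg ℚ ↥(adjoin ℚ (Set.range z ∪ Set.range (cexp ∘ z))) + 1 := by
  have h1 : ((a + v : ℕ) : Cardinal) ≤ Algebra.trdeg ℚ ↥(adjoin ℚ (Set.range z ∪ Set.range (cexp ∘ z))) := by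
    push_cast
    exact (add_le_add ha hv).trans hsplit
  calc (n : Cardinal) ≤ ((a + v + 1 : ℕ) : Cardinal) := by exact_mod_cast hn
    _ = ((a + v : ℕ) : Cardinal) + 1 := by push_cast; rfl
    _ ≤ _ := add_le_add h1 (le_refl _)

/-- **ADDITIVE CERTIFICATE ⟹ SCHANUEL.**  Same with `n ≤ a + v`: items S / D's conclusion `n ≤ t`. -/
theorem le_trdeg_of_additive_cert {n : ℕ} (z : Fin n → ℂ) {a v : ℕ}
    (ha : (a : Cardinal) ≤ Algebra.trdeg ℚ ↥(adjoin ℚ (Set.range z)))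
    (hv : (v : Cardinal) ≤ Algebra.trdeg ℚ ↥(adjoin ℚ (Set.range (cexp ∘ z))))
    (hsplit : Algebra.trdeg ℚ ↥(adjoin ℚ (Set.range z)) + Algebra.trdeg ℚ ↥(adjoin ℚ (Set.range (cexp ∘ z))) ≤
      Algebra.trdeg ℚ ↥(adjoin ℚ (Set.range z ∪ Set.range (cexp ∘ z))))
    (hn : n ≤ a + v) :
    (n : Cardinal) ≤ Algebra.trdeg ℚ ↥(adjoin ℚ (Set.range z ∪ Set.range (cexp ∘ z))) := by
  have h1 : ((a + v : ℕ) : Cardinal) ≤ Algebra.trdeg ℚ ↥(adjoin ℚ (Set.range z ∪ Set.range (cexp ∘ z))) := by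
    push_cast
    exact (add_le_add ha hv).trans hsplit
  exact le_trans (by exact_mod_cast hn) h1

/-! ## §4  ITEM B (`DefectOneSchanuel`, stmt-Schanuel-25020) AT LENGTH `≤ 4` ON THE DISJOINT STRATUM -/

/-- **VALUE TWO + SPLIT ⟹ B at length ≤ 4.**  If `2 ≤ trdeg ℚ(e^z)` is certified and `ε = 0`, then `n ≤ t + 1`
for `n ≤ 4`: either `z ⊂ ℚ̄` (Lindemann–Weierstrass: `n ≤ trdeg ℚ(e^z) ≤ t`) or some `z_i ∉ ℚ̄`
(`a = 1`, `v = 2`, `1 + 2 + 1 = 4 ≥ n`). -/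
theorem defectOne_of_valueTwo_split {n : ℕ} (hn : n ≤ 4) (z : Fin n → ℂ) (hz : LinearIndependent ℚ z)
    (hv : (2 : Cardinal) ≤ Algebra.trdeg ℚ ↥(adjoin ℚ (Set.range (cexp ∘ z))))
    (hsplit : Algebra.trdeg ℚ ↥(adjoin ℚ (Set.range z)) + Algebra.trdeg ℚ ↥(adjoin ℚ (Set.range (cexp ∘ z))) ≤
      Algebra.trdeg ℚ ↥(adjoin ℚ (Set.range z ∪ Set.range (cexp ∘ z)))) :
    (n : Cardinal) ≤ Algebra.trdeg ℚ ↥(adjoin ℚ (Set.range z ∪ Set.range (cexp ∘ z))) + 1 := by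
  by_cases h0 : ∀ i, IsAlgebraic ℚ (z i)
  · have h3 : (n : Cardinal) ≤ Algebra.trdeg ℚ ↥(adjoin ℚ (Set.range (cexp ∘ z))) :=
      le_valDegree_of_exp_algebraic_mem z z h0 hz fun j => subset_adjoin ℚ _ ⟨j, rfl⟩
    exact (h3.trans (trdeg_vals_le z)).trans (self_le_add_right _ _)
  · obtain ⟨i, hi⟩ := not_forall.mp h0
    have h1 : (1 : Cardinal) ≤ Algebra.trdeg ℚ ↥(adjoin ℚ (Set.range z)) :=
      one_le_trdeg_adjoin_of_transcendental hi ⟨i, rfl⟩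
    exact le_trdeg_succ_of_additive_cert z (a := 1) (v := 2) (by simpa using h1) (by simpa using hv) hsplit
      (by omega)

/-- **B₄-CELL (C1) «LW pair»** = item `DefectOneSchanuel` with `n ≤ 4`, the cell «`span_ℚ z` contains two ℚ-free
ALGEBRAIC numbers» and the split inserted (binders otherwise verbatim).  `v = 2` by Lindemann–Weierstrass. -/
theorem defectOneSchanuel_four_cell_lwPair :
    ∀ (n : ℕ) (z : Fin n → ℂ), LinearIndependent ℚ z → n ≤ 4 →
      (∃ b : Fin 2 → ℂ, LinearIndependent ℚ b ∧ (∀ j, IsAlgebraic ℚ (b j)) ∧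
        ∀ j, b j ∈ Submodule.span ℚ (Set.range z)) →
      (Algebra.trdeg ℚ ↥(IntermediateField.adjoin ℚ (Set.range z)) +
          Algebra.trdeg ℚ ↥(IntermediateField.adjoin ℚ (Set.range (Complex.exp ∘ z))) ≤
        Algebra.trdeg ℚ ↥(IntermediateField.adjoin ℚ (Set.range z ∪ Set.range (Complex.exp ∘ z)))) →
      (n : Cardinal) ≤ Algebra.trdeg ℚ ↥(IntermediateField.adjoin ℚ (Set.range z ∪ Set.range (Complex.exp ∘ z))) + 1 := by
  intro n z hz hn hcell hsplit
  obtain ⟨b, hb, hbalg, hmem⟩ := hcell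
  have hv : ((2 : ℕ) : Cardinal) ≤ Algebra.trdeg ℚ ↥(adjoin ℚ (Set.range (cexp ∘ z))) :=
    le_valDegree_of_lwSpan z b hb hbalg hmem
  exact defectOne_of_valueTwo_split hn z hz (by simpa using hv) hsplit

/-- **B₄-CELL (C2) «number-field line»** = item `DefectOneSchanuel` with `n ≤ 4`, the cell «`μβ^k ∈ span_ℚ z` for
all `k`, `β ∈ ℚ̄` of degree `≥ 3`, `μ ≠ 0`» and the split inserted.  `v = 2` by Theorem 2.9 (`(3,3)`, `t₁`-clause).
Every E-stable quartic line `μ·(1, β, β², β³)`, `[ℚ(β):ℚ] = 4`, ANY base `μ` (e.g. `μ = π`, `μ = e`) is a member;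
for `μ ∉ ℚ̄` these have `trdeg ℚ(z) = 1` and, for `μ ∉ ℚ̄·𝓛`, are `𝕃`-free. -/
theorem defectOneSchanuel_four_cell_numberFieldLine (h29 : smallTrdeg_thm_2_9_pos) :
    ∀ (n : ℕ) (z : Fin n → ℂ), LinearIndependent ℚ z → n ≤ 4 →
      (∃ β μ : ℂ, IsAlgebraic ℚ β ∧ 3 ≤ (minpoly ℚ β).natDegree ∧ μ ≠ 0 ∧
        ∀ k : ℕ, μ * β ^ k ∈ Submodule.span ℚ (Set.range z)) →
      (Algebra.trdeg ℚ ↥(IntermediateField.adjoin ℚ (Set.range z)) +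
          Algebra.trdeg ℚ ↥(IntermediateField.adjoin ℚ (Set.range (Complex.exp ∘ z))) ≤
        Algebra.trdeg ℚ ↥(IntermediateField.adjoin ℚ (Set.range z ∪ Set.range (Complex.exp ∘ z)))) →
      (n : Cardinal) ≤ Algebra.trdeg ℚ ↥(IntermediateField.adjoin ℚ (Set.range z ∪ Set.range (Complex.exp ∘ z))) + 1 := by
  intro n z hz hn hcell hsplit
  obtain ⟨β, μ, hβ, hdeg, hμ, hmem⟩ := hcell
  exact defectOne_of_valueTwo_split hn z hz (two_le_valDegree_of_numberFieldLine h29 z hβ hdeg hμ hmem) hsplit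

/-- **B₄-CELL (C3) «algebraic frame with an irrational multiplier»** = item `DefectOneSchanuel` with `n ≤ 4`, the
cell «`span_ℚ z ⊇ μ·a ∪ μρ·a`, `a ⊂ ℚ̄` ℚ-free of length `≥ 4`, `ρ ∈ ℚ̄ ∖ ℚ`, `μ ≠ 0`» and the split inserted.
`v = 2` by Theorem 2.9 (`(d,2)`, `t₁`-clause).  At `n = 4` this is EVERY E-stable span `μ·K₀`, `K₀ ⊂ ℚ̄`. -/
theorem defectOneSchanuel_four_cell_algebraicFrame (h29 : smallTrdeg_thm_2_9_pos) :
    ∀ (n : ℕ) (z : Fin n → ℂ), LinearIndependent ℚ z → n ≤ 4 →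
      (∃ (d : ℕ) (a : Fin d → ℂ) (ρ μ : ℂ), 4 ≤ d ∧ LinearIndependent ℚ a ∧ (∀ i, IsAlgebraic ℚ (a i)) ∧
        ρ ∉ Set.range (algebraMap ℚ ℂ) ∧ μ ≠ 0 ∧ (∀ i, μ * a i ∈ Submodule.span ℚ (Set.range z)) ∧
        ∀ i, μ * ρ * a i ∈ Submodule.span ℚ (Set.range z)) →
      (Algebra.trdeg ℚ ↥(IntermediateField.adjoin ℚ (Set.range z)) +
          Algebra.trdeg ℚ ↥(IntermediateField.adjoin ℚ (Set.range (Complex.exp ∘ z))) ≤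
        Algebra.trdeg ℚ ↥(IntermediateField.adjoin ℚ (Set.range z ∪ Set.range (Complex.exp ∘ z)))) →
      (n : Cardinal) ≤ Algebra.trdeg ℚ ↥(IntermediateField.adjoin ℚ (Set.range z ∪ Set.range (Complex.exp ∘ z))) + 1 := by
  intro n z hz hn hcell hsplit
  obtain ⟨d, a, ρ, μ, hd, ha, haalg, hρ, hμ, hmem₀, hmem₁⟩ := hcell
  exact defectOne_of_valueTwo_split hn z hz (two_le_valDegree_of_algebraicFrame h29 z a hd ha haalg hρ hμ hmem₀ hmem₁)
    hsplit

/-- **B₄-CELL (C4) «argument-rich»**: two algebraically independent ARGUMENTS in `ℚ(z)` (e.g. `π, e^π ∈ ℚ(z)` by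
Nesterenko, lens 2's `algebraicIndependent_pi_exp_pi`) and one entry with a transcendental exponential give
`a = 2`, `v = 1`, hence B at length `≤ 4` under the split. -/
theorem defectOne_four_cell_argRich {n : ℕ} (hn : n ≤ 4) (z : Fin n → ℂ) {u : Fin 2 → ℂ}
    (hu : AlgebraicIndependent ℚ u) (humem : ∀ j, u j ∈ adjoin ℚ (Set.range z))
    (hv : ∃ i, Transcendental ℚ (cexp (z i)))
    (hsplit : Algebra.trdeg ℚ ↥(adjoin ℚ (Set.range z)) + Algebra.trdeg ℚ ↥(adjoin ℚ (Set.range (cexp ∘ z))) ≤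
      Algebra.trdeg ℚ ↥(adjoin ℚ (Set.range z ∪ Set.range (cexp ∘ z)))) :
    (n : Cardinal) ≤ Algebra.trdeg ℚ ↥(adjoin ℚ (Set.range z ∪ Set.range (cexp ∘ z))) + 1 := by
  obtain ⟨i, hi⟩ := hv
  have ha : ((2 : ℕ) : Cardinal) ≤ Algebra.trdeg ℚ ↥(adjoin ℚ (Set.range z)) :=
    Summit.Schanuel.Schanuel.Theorems.RootDecomp1ArgumentCells.le_trdeg_of_algebraicIndependent_mem _ hu humem
  have hv1 : (1 : Cardinal) ≤ Algebra.trdeg ℚ ↥(adjoin ℚ (Set.range (cexp ∘ z))) :=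
    one_le_trdeg_adjoin_of_transcendental hi ⟨i, rfl⟩
  exact le_trdeg_succ_of_additive_cert z (v := 1) ha (by simpa using hv1) hsplit (by omega)

end Summit.Schanuel.Schanuel.Theorems.RootDecomp1AdditiveCells

end
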